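import Literature.Geometry.Kaehler.ComplexTorusIntegralHodgeLatticeLefschetzPiecesRank
import HarnessLib

/-!
# The index recursion of the integral Lefschetz decomposition:
# `[Hdgᵖ⁺¹(X, ℤ) : ⊕_s N'_s] = [Hdgᵖ⁺¹(X, ℤ) : θ ∧ Hdgᵖ(X, ℤ) ⊕ Hdgᵖ⁺¹(X, ℤ)_prim] · [Hdgᵖ(X, ℤ) : ⊕_s N_s]`,
# in closed form `[Hdgᵖ(X, ℤ) : ⊕_s N_s] = ∏_{q < p} [Hdg^{q+1}(X, ℤ) : θ ∧ Hdg^q(X, ℤ) ⊕ Hdg^{q+1}(X, ℤ)_prim]`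

Layer `Literature/Geometry/Kaehler`, namespace `Literature.Geometry.Kaehler.ComplexTorus`; lane `lit-hodgefound`
(Track 2 foundations library), seat p09, generation 47, rows g47-#6 (§0–§4) and g47-#7 (§5–§6, same-seat append). THEOREMS ONLY (0 definitions); no named fact, net debt 0.
Ties g47-#1's one-step index `J_{p+1} = [Hdgᵖ⁺¹(X, ℤ) : θ ∧ Hdgᵖ(X, ℤ) ⊕ Hdgᵖ⁺¹(X, ℤ)_prim]` (`ComplexTorusIntegralHodgeLatticeLefschetzImage`) to the
total index `I_p = [Hdgᵖ(X, ℤ) : ⊕_{s ≤ p} Lˢ Hdg^{p−s}(X, ℤ)_prim]` of g47-#3/#4 (`…LefschetzPieces`, `…LefschetzPiecesRank`), for a polarised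
abelian variety of dimension `g = j + 2` with `2p + 2 ≤ g`, in g47-#1's currency (`M' = Hdgᵖ(X, ℤ) ⊆ H^{2p}(X, ℤ)` and `M = Hdgᵖ⁺¹(X, ℤ) ⊆ H^{2p+2}(X, ℤ)`
cut out by type, `T : M' → M` the Lefschetz map `x ↦ x ∧ θ`, `L₂ = T(M')`, `P ⊆ M` the primitive sublattice; `N`, `N'` the families of Lefschetz
pieces in degrees `2p`, `2p + 2` by their membership predicates):

* §0 (private) lattice generalities: `(A ⊔ B)_{AddSubgroup} = A ⊔ B`; **`[A ⊕ B : A ⊕ B'] = [B : B']`** for `A ⊓ B = 0`, `B' ⊆ B` (modular law +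
  second isomorphism theorem).
* §1 `T` is injective and **`P ⊓ L₂ = 0`** WITHOUT bilinear forms: a primitive class of the form `β ∧ θ` vanishes by hard Lefschetz
  (`IsPolarizationType.lefschetz_linearMap_injective_of_le`, `….primitive_inf_lefschetzImage_eq_bot`).
* §2 **THE PIECES SHIFT: `⊕_s N'_s = P ⊕ T(⊕_s N_s)`** inside `M` (`IsRiemannForm.comap_subtype_iSup_lefschetzPieces_succ_eq`): `N'_0 = P` and
  `N'_{s+1} = θ ∧ N_s` (`L^{s+1} y = (Lˢ y) ∧ θ`).
* §3 **THE INDEX RECURSION `I_{p+1} = J_{p+1} · I_p`** (`IsPolarizationType.index_comap_iSup_lefschetzPieces_succ_eq_mul`):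
  `[M : P ⊕ T(S)] = [M : P ⊕ L₂] · [P ⊕ L₂ : P ⊕ T(S)]`, `[P ⊕ L₂ : P ⊕ T(S)] = [L₂ : T(S)] = [M' : S]` (`T` injective), `S = ⊕_s N_s`; and the
  bridge `….index_comap_subtype_eq_index_comap_inclusion` to g47-#4's formulation of `I_p` on `↥Hdgᵖ(X, ℤ)`, so that g47-#4's bound
  `I_p ∣ N₀^{rk}` and g47-#1's `J ∣ c^{rk} · |disc Hdgᵖ|` combine along the ladder; in that currency
  (`IsPolarizationType.index_comap_inclusion_iSup_lefschetzPieces_succ_eq_mul`) the recursion also yields **`0 < J_{p+1}`** with no bilinear form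
  in the hypotheses (g47-#4: `0 < I_{p+1}`).
* §5 **`I_0 = 1`** (`index_comap_iSup_lefschetzPieces_zero_eq_one`): in degree `0` every class is primitive, `N_0 = Hdg⁰(X, ℤ)`.
* §6 **THE CLOSED FORM `I_p = ∏_{q < p} J_{q+1}`** along a whole ladder of data indexed by the codimension
  (`IsPolarizationType.index_comap_iSup_lefschetzPieces_eq_prod`): §5 and §3 iterated.

## References

* [cite: Lange2023AbelianVarietiesComplex, §5.4.1 Thm. 5.4.2 and (5.22)–(5.23) (PDF p. 275); §7.3.2 (1), (3)]
* [cite: VoisinHodgeI2002, §6.2.3 Prop. 6.22, Lemma 6.26, Rem. 6.27 (PDF p. 126); §6.3.2 Lemma 6.31 (PDF p. 128)]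
* [cite: Huybrechts2016K3, Ch. 14 §0.1 (0.1), (0.2), §0.2]
* [cite: Kitaoka1993, Ch. 5 §5.3 Prop. 5.3.3 (proof)]
-/

noncomputable section

-- `Module ℂ` / `SMulZeroClass ℂ` synthesis on `E [⋀^Fin k]→L[ℝ] ℂ` (as in `ComplexTorusLefschetzDecomposition`)
set_option maxSynthPendingDepth 3

open Module Function Complex
open LinearMap (BilinForm)
open Literature.LinearAlgebra.Alternating
open Literature.Analysis.Complex (IsOfTypeAt typeSubmodule mem_typeSubmodule_iff_isOfTypeAt)

namespace Literature.Geometry.Kaehler.ComplexTorus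

/-! ## §0 Lattice generalities -/

section Generic

variable {R M : Type*} [Ring R] [AddCommGroup M] [Module R M]

/-- `(A ⊔ B).toAddSubgroup = A.toAddSubgroup ⊔ B.toAddSubgroup`. [folklore] -/
private theorem sup_toAddSubgroup₈₆ (A B : Submodule R M) : (A ⊔ B).toAddSubgroup = A.toAddSubgroup ⊔ B.toAddSubgroup := by
  refine le_antisymm ?_ (sup_le (Submodule.toAddSubgroup_mono le_sup_left) (Submodule.toAddSubgroup_mono le_sup_right))
  intro x hx
  obtain ⟨a, ha, b, hb, rfl⟩ := Submodule.mem_sup.1 hx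
  exact AddSubgroup.add_mem _ (AddSubgroup.mem_sup_left ha) (AddSubgroup.mem_sup_right hb)

/-- **`[A ⊕ B : A ⊕ B'] = [B : B']`** for submodules `A`, `B' ⊆ B` with `A ⊓ B = 0`: the modular law `(A ⊔ B') ⊓ B = B'` and the second
isomorphism theorem `[B ⊔ K : K] = [B : B ⊓ K]` for `K = A ⊔ B'`. [folklore] -/
private theorem relIndex_sup_left_eq₈₆ {A B B' : Submodule R M} (hAB : A ⊓ B = ⊥) (hB' : B' ≤ B) :
    (A ⊔ B').toAddSubgroup.relIndex (A ⊔ B).toAddSubgroup = B'.toAddSubgroup.relIndex B.toAddSubgroup := by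
  have hmod : (A ⊔ B') ⊓ B = B' := by
    rw [sup_comm A B', sup_inf_assoc_of_le A hB', hAB, sup_bot_eq]
  have hsup : B.toAddSubgroup ⊔ (A ⊔ B').toAddSubgroup = (A ⊔ B).toAddSubgroup := by
    rw [← sup_toAddSubgroup₈₆, sup_left_comm, sup_eq_left.2 hB']
  have hinf : (A ⊔ B').toAddSubgroup ⊓ B.toAddSubgroup = ((A ⊔ B') ⊓ B).toAddSubgroup := AddSubgroup.ext fun _ ↦ Iff.rfl
  calc (A ⊔ B').toAddSubgroup.relIndex (A ⊔ B).toAddSubgroup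
      = (A ⊔ B').toAddSubgroup.relIndex (B.toAddSubgroup ⊔ (A ⊔ B').toAddSubgroup) := by rw [hsup]
    _ = (A ⊔ B').toAddSubgroup.relIndex B.toAddSubgroup := AddSubgroup.relIndex_sup_right _ _
    _ = ((A ⊔ B').toAddSubgroup ⊓ B.toAddSubgroup).relIndex B.toAddSubgroup := (AddSubgroup.inf_relIndex_right _ _).symm
    _ = B'.toAddSubgroup.relIndex B.toAddSubgroup := by rw [hinf, hmod]

end Generic

section Recursion

variable {ι : Type*} [Fintype ι] [DecidableEq ι] {E : Type*} [NormedAddCommGroup E] [NormedSpace ℂ E]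
  {Φ : (ι → ℝ) ≃L[ℝ] E} {j p : ℕ} {η : E [⋀^Fin 2]→L[ℝ] ℝ} {d : Fin (j + 2) → ℕ}

omit [Fintype ι] [DecidableEq ι] in
/-- Re-indexing the exponent of the bundled Lefschetz power along a (propositional) equality of exponents. [folklore] -/
private theorem lefschetzPow_congr₈₆ (η : E [⋀^Fin 2]→L[ℝ] ℝ) {r₁ r₂ m k : ℕ} (hr : r₁ = r₂) (h₁ : 2 * r₁ + m = k) (h₂ : 2 * r₂ + m = k)
    (y : E [⋀^Fin m]→L[ℝ] ℂ) : lefschetzPow η r₁ h₁ y = lefschetzPow η r₂ h₂ y := by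
  subst hr
  rfl

/-! ## §1 `T` injective and `P ⊓ L₂ = 0` by hard Lefschetz -/

omit [DecidableEq ι] in
/-- **The Lefschetz map `T : Hdgᵖ(X, ℤ) → Hdgᵖ⁺¹(X, ℤ)`, `x ↦ x ∧ θ`, is injective for `2p + 2 ≤ g`** — hard Lefschetz: `L¹ : H^{2p} → H^{2p+2}` is injective
for `2p + 1 ≤ g` (the tree's `lefschetzPow_injective`); no bilinear form is needed (compare g47-#1's `lefschetz_linearMap_injective`, through the
similarity). [cite: Lange2023AbelianVarietiesComplex, §7.3.2 (1), (3)] [cite: VoisinHodgeI2002, §6.2.3 Lemma 6.26, Rem. 6.27 (PDF p. 126)] -/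
theorem IsPolarizationType.lefschetz_linearMap_injective_of_le (hd : IsPolarizationType Φ η d) (hη : IsRiemannForm Φ η) (hp : 2 * p + 2 ≤ j + 2)
    {M : Submodule ℤ ↥(integralForms Φ (2 * p + 2))} {M' : Submodule ℤ ↥(integralForms Φ (2 * p))} (T : ↥M' →ₗ[ℤ] ↥M)
    (hT : ∀ x : ↥M', (((T x : ↥M) : ↥(integralForms Φ (2 * p + 2))) : E [⋀^Fin (2 * p + 2)]→L[ℝ] ℂ) =
      (((x : ↥M') : ↥(integralForms Φ (2 * p))) : E [⋀^Fin (2 * p)]→L[ℝ] ℂ).wedge (ofRealForm η : E [⋀^Fin 2]→L[ℝ] ℂ)) :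
    Injective T := by
  haveI : FiniteDimensional ℝ E := Module.Finite.equiv Φ.toLinearEquiv
  haveI : FiniteDimensional ℂ E := Module.Finite.of_restrictScalars_finite ℝ ℂ E
  have hE : finrank ℝ E = Fintype.card ι := by
    rw [← Φ.toLinearEquiv.finrank_eq, Module.finrank_fintype_fun_eq_card]
  have hg : finrank ℂ E = j + 2 := by
    have h := finrank_real_of_complex E
    rw [hE, hd.card_eq] at h
    omega
  have hnd : ∀ v : E, v ≠ 0 → ∃ w : E, η ![v, w] ≠ 0 := fun v hv ↦ by
    by_contra h
    push Not at h
    exact hv (hη.nondegenerate v h)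
  have h1 : 2 * 1 + 2 * p = 2 * p + 2 := by ring
  rw [← LinearMap.ker_eq_bot, LinearMap.ker_eq_bot']
  intro x hx
  have hx' : lefschetzPow η 1 h1 (((x : ↥M') : ↥(integralForms Φ (2 * p))) : E [⋀^Fin (2 * p)]→L[ℝ] ℂ) = 0 := by
    rw [lefschetzPow_one_eq_wedge_ofRealForm, ← hT, hx]
    rfl
  have h0 := lefschetzPow_injective hnd h1 (by omega) (hx'.trans (map_zero _).symm)
  exact Subtype.ext (Subtype.ext h0)

omit [DecidableEq ι] in
/-- **`Hdgᵖ⁺¹(X, ℤ)_prim ∩ (θ ∧ Hdgᵖ(X, ℤ)) = 0`** (`2p + 2 ≤ g`) WITHOUT bilinear forms: a primitive `(2p+2)`-class of the form `β ∧ θ = L¹ β` is zero,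
since `P^{2p+2} ∩ L¹ H^{2p} = 0` (the first step of the Lefschetz decomposition, the tree's `disjoint_primitiveForms_range_lefschetzPow`).
[cite: VoisinHodgeI2002, §6.2.3 Prop. 6.22 (PDF p. 126)] [cite: Lange2023AbelianVarietiesComplex, §7.3.2 (3)] -/
theorem IsPolarizationType.primitive_inf_lefschetzImage_eq_bot (hd : IsPolarizationType Φ η d) (hη : IsRiemannForm Φ η) (hp : 2 * p + 2 ≤ j + 2)
    {M : Submodule ℤ ↥(integralForms Φ (2 * p + 2))} {M' : Submodule ℤ ↥(integralForms Φ (2 * p))} (T : ↥M' →ₗ[ℤ] ↥M)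
    (hT : ∀ x : ↥M', (((T x : ↥M) : ↥(integralForms Φ (2 * p + 2))) : E [⋀^Fin (2 * p + 2)]→L[ℝ] ℂ) =
      (((x : ↥M') : ↥(integralForms Φ (2 * p))) : E [⋀^Fin (2 * p)]→L[ℝ] ℂ).wedge (ofRealForm η : E [⋀^Fin 2]→L[ℝ] ℂ))
    {L₂ : Submodule ℤ ↥M} (hmemL₂ : ∀ u : ↥M, u ∈ L₂ ↔ ∃ w : ↥M', T w = u) {P : Submodule ℤ ↥M}
    (hP : ∀ z : ↥M, z ∈ P ↔ (((z : ↥M) : ↥(integralForms Φ (2 * p + 2))) : E [⋀^Fin (2 * p + 2)]→L[ℝ] ℂ) ∈ primitiveForms η (2 * p + 2)) :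
    P ⊓ L₂ = ⊥ := by
  haveI : FiniteDimensional ℝ E := Module.Finite.equiv Φ.toLinearEquiv
  haveI : FiniteDimensional ℂ E := Module.Finite.of_restrictScalars_finite ℝ ℂ E
  have hE : finrank ℝ E = Fintype.card ι := by
    rw [← Φ.toLinearEquiv.finrank_eq, Module.finrank_fintype_fun_eq_card]
  have hg : finrank ℂ E = j + 2 := by
    have h := finrank_real_of_complex E
    rw [hE, hd.card_eq] at h
    omega
  have hnd : ∀ v : E, v ≠ 0 → ∃ w : E, η ![v, w] ≠ 0 := fun v hv ↦ by
    by_contra h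
    push Not at h
    exact hv (hη.nondegenerate v h)
  have h1 : 2 * 1 + 2 * p = 2 * p + 2 := by ring
  have hdis := disjoint_primitiveForms_range_lefschetzPow hnd h1 (by omega : 2 * p + 2 ≤ finrank ℂ E)
  rw [eq_bot_iff]
  intro z hz
  obtain ⟨hzP, hzL⟩ := Submodule.mem_inf.1 hz
  obtain ⟨w, hw⟩ := (hmemL₂ z).1 hzL
  have hform : (((z : ↥M) : ↥(integralForms Φ (2 * p + 2))) : E [⋀^Fin (2 * p + 2)]→L[ℝ] ℂ) = 0 := by
    refine (Submodule.disjoint_def.1 hdis) _ ((hP z).1 hzP) ⟨(((w : ↥M') : ↥(integralForms Φ (2 * p))) : E [⋀^Fin (2 * p)]→L[ℝ] ℂ), ?_⟩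
    rw [lefschetzPow_one_eq_wedge_ofRealForm, ← hT, hw]
  rw [Submodule.mem_bot]
  exact Subtype.ext (Subtype.ext hform)

/-! ## §2 The pieces shift: `⊕_s N'_s = P ⊕ T(⊕_s N_s)` -/

omit [Fintype ι] [DecidableEq ι] in
/-- **THE LEFSCHETZ PIECES SHIFT UNDER `T`: `⊕_{s ≤ p+1} N'_s = P ⊕ T(⊕_{s ≤ p} N_s)`** inside `M = Hdgᵖ⁺¹(X, ℤ)`: the degree-`(2p+2)` pieces are
`N'_0 = Hdgᵖ⁺¹(X, ℤ)_prim = P` and `N'_{s+1} = θ ∧ N_s` (`L^{s+1} y = (Lˢ y) ∧ θ = T(Lˢ y)`), so the trace of `⨆_s N'_s` on `M` is `P ⊔ T(S)` with `S`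
the trace of `⨆_s N_s` on `M' = Hdgᵖ(X, ℤ)`. [cite: VoisinHodgeI2002, §6.2.3 Prop. 6.22, Rem. 6.27 (PDF p. 126)] [cite: Lange2023AbelianVarietiesComplex, §5.4.1 (5.22)–(5.23) (PDF p. 275); §7.3.2 (3)] -/
theorem IsRiemannForm.comap_subtype_iSup_lefschetzPieces_succ_eq (hη : IsRiemannForm Φ η)
    {M : Submodule ℤ ↥(integralForms Φ (2 * p + 2))}
    (hM : ∀ x : ↥(integralForms Φ (2 * p + 2)), x ∈ M ↔ IsOfTypeAt (p + 1) (p + 1) (x : E [⋀^Fin (2 * p + 2)]→L[ℝ] ℂ))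
    {M' : Submodule ℤ ↥(integralForms Φ (2 * p))}
    (hM' : ∀ x : ↥(integralForms Φ (2 * p)), x ∈ M' ↔ IsOfTypeAt p p (x : E [⋀^Fin (2 * p)]→L[ℝ] ℂ)) (T : ↥M' →ₗ[ℤ] ↥M)
    (hT : ∀ x : ↥M', (((T x : ↥M) : ↥(integralForms Φ (2 * p + 2))) : E [⋀^Fin (2 * p + 2)]→L[ℝ] ℂ) =
      (((x : ↥M') : ↥(integralForms Φ (2 * p))) : E [⋀^Fin (2 * p)]→L[ℝ] ℂ).wedge (ofRealForm η : E [⋀^Fin 2]→L[ℝ] ℂ))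
    {P : Submodule ℤ ↥M}
    (hP : ∀ z : ↥M, z ∈ P ↔ (((z : ↥M) : ↥(integralForms Φ (2 * p + 2))) : E [⋀^Fin (2 * p + 2)]→L[ℝ] ℂ) ∈ primitiveForms η (2 * p + 2))
    (N : Fin (p + 1) → Submodule ℤ ↥(integralForms Φ (2 * p)))
    (hN : ∀ (s : Fin (p + 1)) (u : ↥(integralForms Φ (2 * p))), u ∈ N s ↔
      ∃ (m i : ℕ) (_ : i + i = m) (h : 2 * (s : ℕ) + m = 2 * p) (y : E [⋀^Fin m]→L[ℝ] ℂ),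
        y ∈ integralHodgeClassesIn Φ m i ∧ y ∈ primitiveForms η m ∧ (u : E [⋀^Fin (2 * p)]→L[ℝ] ℂ) = lefschetzPow η (s : ℕ) h y)
    (N' : Fin (p + 1 + 1) → Submodule ℤ ↥(integralForms Φ (2 * p + 2)))
    (hN' : ∀ (s : Fin (p + 1 + 1)) (u : ↥(integralForms Φ (2 * p + 2))), u ∈ N' s ↔
      ∃ (m i : ℕ) (_ : i + i = m) (h : 2 * (s : ℕ) + m = 2 * p + 2) (y : E [⋀^Fin m]→L[ℝ] ℂ),
        y ∈ integralHodgeClassesIn Φ m i ∧ y ∈ primitiveForms η m ∧ (u : E [⋀^Fin (2 * p + 2)]→L[ℝ] ℂ) = lefschetzPow η (s : ℕ) h y) :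
    (⨆ s, N' s).comap M.subtype = P ⊔ ((⨆ s, N s).comap M'.subtype).map T := by
  have h1 : 2 * 1 + 2 * p = 2 * p + 2 := by ring
  -- Hodge type of the elements of `M`, `M'` and of the pieces
  have hMH : ∀ z : ↥M, (((z : ↥M) : ↥(integralForms Φ (2 * p + 2))) : E [⋀^Fin (2 * p + 2)]→L[ℝ] ℂ) ∈
      integralHodgeClassesIn Φ (2 * p + 2) (p + 1) := fun z ↦
    (mem_integralHodgeClassesIn_iff Φ).2 ⟨((z : ↥M) : ↥(integralForms Φ (2 * p + 2))).2,
      (mem_typeSubmodule_iff_isOfTypeAt (by ring)).2 ((hM _).1 z.2)⟩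
  have hmemM' : ∀ x : ↥(integralForms Φ (2 * p)), (x : E [⋀^Fin (2 * p)]→L[ℝ] ℂ) ∈ integralHodgeClassesIn Φ (2 * p) p → x ∈ M' :=
    fun x hx ↦ (hM' x).2 ((mem_typeSubmodule_iff_isOfTypeAt (by ring)).1 ((mem_integralHodgeClassesIn_iff Φ).1 hx).2)
  have hmemM : ∀ x : ↥(integralForms Φ (2 * p + 2)),
      (x : E [⋀^Fin (2 * p + 2)]→L[ℝ] ℂ) ∈ integralHodgeClassesIn Φ (2 * p + 2) (p + 1) → x ∈ M :=
    fun x hx ↦ (hM x).2 ((mem_typeSubmodule_iff_isOfTypeAt (by ring)).1 ((mem_integralHodgeClassesIn_iff Φ).1 hx).2)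
  refine le_antisymm ?_ (sup_le ?_ ?_)
  · -- `⊆`: decompose `↑u ∈ ⨆ N'_s` along the pieces
    intro u hu
    have key : ∀ x ∈ ⨆ s, N' s, ∃ v : ↥M, (v : ↥(integralForms Φ (2 * p + 2))) = x ∧ v ∈ P ⊔ ((⨆ s, N s).comap M'.subtype).map T := by
      intro x hx
      refine Submodule.iSup_induction N' (motive := fun x ↦ ∃ v : ↥M, (v : ↥(integralForms Φ (2 * p + 2))) = x ∧
        v ∈ P ⊔ ((⨆ s, N s).comap M'.subtype).map T) hx ?_ ?_ ?_
      · rintro ⟨s, hslt⟩ x hxs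
        obtain ⟨m, i, hm, h, y, hyH, hyP, hxy⟩ := (hN' ⟨s, hslt⟩ x).1 hxs
        cases s with
        | zero =>
          -- `N'_0 = P`
          obtain rfl : m = 2 * p + 2 := by simpa using h
          have hx0 : (x : E [⋀^Fin (2 * p + 2)]→L[ℝ] ℂ) = y := by
            rw [hxy, lefschetzPow_congr₈₆ η (show ((⟨0, hslt⟩ : Fin (p + 1 + 1)) : ℕ) = 0 from rfl) h (by ring) y,
              lefschetzPow_zero_apply]
          obtain rfl : i = p + 1 := by omega
          have hxM : x ∈ M := hmemM x (by rw [hx0]; exact hyH)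
          refine ⟨⟨x, hxM⟩, rfl, Submodule.mem_sup_left ((hP _).2 ?_)⟩
          show (x : E [⋀^Fin (2 * p + 2)]→L[ℝ] ℂ) ∈ primitiveForms η (2 * p + 2)
          rw [hx0]
          exact hyP
        | succ s₀ =>
          -- `N'_{s₀+1} = T(N_{s₀})`
          have h₀ : 2 * s₀ + m = 2 * p := by simp at h; omega
          have hip : s₀ + i = p := by omega
          have hv₀Z : lefschetzPow η s₀ h₀ y ∈ integralForms Φ (2 * p) :=
            lefschetzPow_mem_integralForms hη h₀ ((mem_integralHodgeClassesIn_iff Φ).1 hyH).1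
          have hv₀H : lefschetzPow η s₀ h₀ y ∈ integralHodgeClassesIn Φ (2 * p) p := lefschetzPow_mem_integralHodgeClassesIn hη h₀ hip hyH
          have hv₀N : (⟨lefschetzPow η s₀ h₀ y, hv₀Z⟩ : ↥(integralForms Φ (2 * p))) ∈ N ⟨s₀, by omega⟩ :=
            (hN ⟨s₀, by omega⟩ _).2 ⟨m, i, hm, h₀, y, hyH, hyP, rfl⟩
          let w : ↥M' := ⟨⟨lefschetzPow η s₀ h₀ y, hv₀Z⟩, hmemM' _ hv₀H⟩
          have hwS : w ∈ (⨆ s, N s).comap M'.subtype := Submodule.mem_iSup_of_mem (⟨s₀, by omega⟩ : Fin (p + 1)) hv₀N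
          have hTw : ((T w : ↥M) : ↥(integralForms Φ (2 * p + 2))) = x := by
            apply Subtype.ext
            rw [hT, hxy, ← lefschetzPow_one_eq_wedge_ofRealForm η h1, lefschetzPow_lefschetzPow,
              lefschetzPow_congr₈₆ η (by simp [Nat.add_comm]) _ h y]
          exact ⟨T w, hTw, Submodule.mem_sup_right (Submodule.mem_map_of_mem hwS)⟩
      · exact ⟨0, rfl, Submodule.zero_mem _⟩
      · rintro x y ⟨v, hv, hvm⟩ ⟨v', hv', hv'm⟩
        exact ⟨v + v', by rw [Submodule.coe_add, hv, hv'], Submodule.add_mem _ hvm hv'm⟩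
    obtain ⟨v, hv, hvm⟩ := key _ hu
    obtain rfl : v = u := Subtype.ext hv
    exact hvm
  · -- `P ≤ comap`: `z = L⁰ z ∈ N'_0`
    intro z hz
    have h0 : 2 * ((0 : Fin (p + 1 + 1)) : ℕ) + (2 * p + 2) = 2 * p + 2 := by simp
    refine Submodule.mem_iSup_of_mem (0 : Fin (p + 1 + 1)) ((hN' 0 _).2 ⟨2 * p + 2, p + 1, by ring, h0, _, hMH z, (hP z).1 hz, ?_⟩)
    rw [lefschetzPow_congr₈₆ η (show ((0 : Fin (p + 1 + 1)) : ℕ) = 0 from rfl) h0 (by ring), lefschetzPow_zero_apply]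
    rfl
  · -- `T(S) ≤ comap`: `T(N_s) ⊆ N'_{s+1}`
    rw [Submodule.map_le_iff_le_comap]
    intro w hw
    have key : ∀ x ∈ ⨆ s, N s, ∃ w' : ↥M', (w' : ↥(integralForms Φ (2 * p))) = x ∧
        ((T w' : ↥M) : ↥(integralForms Φ (2 * p + 2))) ∈ ⨆ s, N' s := by
      intro x hx
      refine Submodule.iSup_induction N (motive := fun x ↦ ∃ w' : ↥M', (w' : ↥(integralForms Φ (2 * p))) = x ∧
        ((T w' : ↥M) : ↥(integralForms Φ (2 * p + 2))) ∈ ⨆ s, N' s) hx ?_ ?_ ?_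
      · intro s x hxs
        obtain ⟨m, i, hm, h, y, hyH, hyP, hxy⟩ := (hN s x).1 hxs
        have hxM' : x ∈ M' := hmemM' x (coe_mem_integralHodgeClassesIn_of_mem_lefschetzPiece hη (by ring) (hN s) hxs)
        refine ⟨⟨x, hxM'⟩, rfl, Submodule.mem_iSup_of_mem (Fin.succ s) ((hN' (Fin.succ s) _).2 ⟨m, i, hm, by simp; omega, y, hyH, hyP, ?_⟩)⟩
        rw [hT]
        show (x : E [⋀^Fin (2 * p)]→L[ℝ] ℂ).wedge (ofRealForm η : E [⋀^Fin 2]→L[ℝ] ℂ) = _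
        rw [hxy, ← lefschetzPow_one_eq_wedge_ofRealForm η h1, lefschetzPow_lefschetzPow]
        exact lefschetzPow_congr₈₆ η (by simp [Nat.add_comm]) _ _ y
      · exact ⟨0, rfl, by rw [map_zero]; exact Submodule.zero_mem _⟩
      · rintro x y ⟨v, hv, hvm⟩ ⟨v', hv', hv'm⟩
        exact ⟨v + v', by rw [Submodule.coe_add, hv, hv'], by rw [map_add, Submodule.coe_add]; exact Submodule.add_mem _ hvm hv'm⟩
    obtain ⟨w', hw', hmem⟩ := key _ hw
    obtain rfl : w' = w := Subtype.ext hw'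
    exact hmem

/-! ## §3 The index recursion `I_{p+1} = J_{p+1} · I_p` -/

omit [DecidableEq ι] in
/-- **THE INDEX RECURSION OF THE INTEGRAL LEFSCHETZ DECOMPOSITION: `[Hdgᵖ⁺¹(X, ℤ) : ⊕_s N'_s] = [Hdgᵖ⁺¹(X, ℤ) : θ ∧ Hdgᵖ(X, ℤ) ⊕ P] · [Hdgᵖ(X, ℤ) : ⊕_s N_s]`**
(`2p + 2 ≤ g`; indices of the traces on `M = Hdgᵖ⁺¹(X, ℤ)`, `M' = Hdgᵖ(X, ℤ)`): by §2 `⊕ N'_s = P ⊕ T(S)`, `S = ⊕ N_s`; the chain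
`P ⊕ T(S) ⊆ P ⊕ L₂ ⊆ M` gives `[M : P ⊕ T(S)] = [M : P ⊕ L₂] · [P ⊕ L₂ : P ⊕ T(S)]`, and `[P ⊕ L₂ : P ⊕ T(S)] = [L₂ : T(S)] = [M' : S]` since
`P ∩ L₂ = 0` (§1) and `T` is injective (§1). With g47-#1 (`J ∣ c^{rk} |disc Hdgᵖ|`, `J > 0`) and g47-#4 (`I_p ∣ N₀^{rk}`) the indices of the whole
ladder are controlled. [cite: Lange2023AbelianVarietiesComplex, §5.4.1 Thm. 5.4.2 and (5.22)–(5.23) (PDF p. 275); §7.3.2 (3)]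
[cite: Huybrechts2016K3, Ch. 14 §0.1 (0.1), (0.2), §0.2] [cite: Kitaoka1993, Ch. 5 §5.3 Prop. 5.3.3 (proof)] [cite: VoisinHodgeI2002, §6.2.3 Prop. 6.22, Rem. 6.27 (PDF p. 126)] -/
theorem IsPolarizationType.index_comap_iSup_lefschetzPieces_succ_eq_mul (hd : IsPolarizationType Φ η d) (hη : IsRiemannForm Φ η)
    (hp : 2 * p + 2 ≤ j + 2) {M : Submodule ℤ ↥(integralForms Φ (2 * p + 2))}
    (hM : ∀ x : ↥(integralForms Φ (2 * p + 2)), x ∈ M ↔ IsOfTypeAt (p + 1) (p + 1) (x : E [⋀^Fin (2 * p + 2)]→L[ℝ] ℂ))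
    {M' : Submodule ℤ ↥(integralForms Φ (2 * p))}
    (hM' : ∀ x : ↥(integralForms Φ (2 * p)), x ∈ M' ↔ IsOfTypeAt p p (x : E [⋀^Fin (2 * p)]→L[ℝ] ℂ)) (T : ↥M' →ₗ[ℤ] ↥M)
    (hT : ∀ x : ↥M', (((T x : ↥M) : ↥(integralForms Φ (2 * p + 2))) : E [⋀^Fin (2 * p + 2)]→L[ℝ] ℂ) =
      (((x : ↥M') : ↥(integralForms Φ (2 * p))) : E [⋀^Fin (2 * p)]→L[ℝ] ℂ).wedge (ofRealForm η : E [⋀^Fin 2]→L[ℝ] ℂ))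
    {L₂ : Submodule ℤ ↥M} (hmemL₂ : ∀ u : ↥M, u ∈ L₂ ↔ ∃ w : ↥M', T w = u) {P : Submodule ℤ ↥M}
    (hP : ∀ z : ↥M, z ∈ P ↔ (((z : ↥M) : ↥(integralForms Φ (2 * p + 2))) : E [⋀^Fin (2 * p + 2)]→L[ℝ] ℂ) ∈ primitiveForms η (2 * p + 2))
    (N : Fin (p + 1) → Submodule ℤ ↥(integralForms Φ (2 * p)))
    (hN : ∀ (s : Fin (p + 1)) (u : ↥(integralForms Φ (2 * p))), u ∈ N s ↔
      ∃ (m i : ℕ) (_ : i + i = m) (h : 2 * (s : ℕ) + m = 2 * p) (y : E [⋀^Fin m]→L[ℝ] ℂ),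
        y ∈ integralHodgeClassesIn Φ m i ∧ y ∈ primitiveForms η m ∧ (u : E [⋀^Fin (2 * p)]→L[ℝ] ℂ) = lefschetzPow η (s : ℕ) h y)
    (N' : Fin (p + 1 + 1) → Submodule ℤ ↥(integralForms Φ (2 * p + 2)))
    (hN' : ∀ (s : Fin (p + 1 + 1)) (u : ↥(integralForms Φ (2 * p + 2))), u ∈ N' s ↔
      ∃ (m i : ℕ) (_ : i + i = m) (h : 2 * (s : ℕ) + m = 2 * p + 2) (y : E [⋀^Fin m]→L[ℝ] ℂ),
        y ∈ integralHodgeClassesIn Φ m i ∧ y ∈ primitiveForms η m ∧ (u : E [⋀^Fin (2 * p + 2)]→L[ℝ] ℂ) = lefschetzPow η (s : ℕ) h y) :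
    ((⨆ s, N' s).comap M.subtype).toAddSubgroup.index =
      (L₂ ⊔ P).toAddSubgroup.index * ((⨆ s, N s).comap M'.subtype).toAddSubgroup.index := by
  have hTinj := hd.lefschetz_linearMap_injective_of_le hη hp T hT
  have hPL := hd.primitive_inf_lefschetzImage_eq_bot hη hp T hT hmemL₂ hP
  have hC := hη.comap_subtype_iSup_lefschetzPieces_succ_eq hM hM' T hT hP N hN N' hN'
  have hL₂ : L₂ = LinearMap.range T := Submodule.ext fun u ↦ by rw [hmemL₂, LinearMap.mem_range]
  have hle : ((⨆ s, N s).comap M'.subtype).map T ≤ L₂ := by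
    rw [hL₂]
    exact LinearMap.map_le_range
  have h1 := AddSubgroup.relIndex_mul_index (H := (P ⊔ ((⨆ s, N s).comap M'.subtype).map T).toAddSubgroup)
    (K := (P ⊔ L₂).toAddSubgroup) (Submodule.toAddSubgroup_mono (sup_le_sup_left hle P))
  have h2 := relIndex_sup_left_eq₈₆ hPL hle
  have h3 : (((⨆ s, N s).comap M'.subtype).map T).toAddSubgroup.relIndex L₂.toAddSubgroup =
      ((⨆ s, N s).comap M'.subtype).toAddSubgroup.index := by
    rw [Submodule.map_toAddSubgroup T ((⨆ s, N s).comap M'.subtype), hL₂, LinearMap.range_toAddSubgroup T,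
      AddMonoidHom.range_eq_map]
    exact (AddSubgroup.relIndex_map_map_of_injective _ _ hTinj).trans (AddSubgroup.relIndex_top_right _)
  rw [hC, ← h1, h2, h3, sup_comm L₂ P, mul_comm]

/-! ## §4 Bridge to the `Hdgᵖ(X, ℤ)`-formulation of g47-#4 -/

omit [Fintype ι] [DecidableEq ι] in
/-- **The two formulations of the index agree**: for any sublattice `S₀ ⊆ Hᵏ(X, ℤ)`, the index of its trace on `M' = {x : type (p, p)}` (g47-#1's
currency) equals the index of its pull-back along the inclusion `Hdgᵖ(X, ℤ) ↪ Hᵏ(X, ℤ)` (g47-#4's currency; `k = p + p`) — the two lattices are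
identified by `x ↦ x`. [cite: Lange2023AbelianVarietiesComplex, §7.2.2; §7.3.2 (3)] -/
theorem index_comap_subtype_eq_index_comap_inclusion {k : ℕ} (hpk : p + p = k) {M' : Submodule ℤ ↥(integralForms Φ k)}
    (hM' : ∀ x : ↥(integralForms Φ k), x ∈ M' ↔ IsOfTypeAt p p (x : E [⋀^Fin k]→L[ℝ] ℂ)) (S₀ : Submodule ℤ ↥(integralForms Φ k)) :
    (S₀.comap M'.subtype).toAddSubgroup.index =
      (S₀.comap (AddSubgroup.inclusion (integralHodgeClassesIn_le_integralForms Φ k p)).toIntLinearMap).toAddSubgroup.index := by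
  have hmemM' : ∀ x : ↥(integralForms Φ k), (x : E [⋀^Fin k]→L[ℝ] ℂ) ∈ integralHodgeClassesIn Φ k p → x ∈ M' :=
    fun x hx ↦ (hM' x).2 ((mem_typeSubmodule_iff_isOfTypeAt hpk).1 ((mem_integralHodgeClassesIn_iff Φ).1 hx).2)
  let φ : ↥(integralHodgeClassesIn Φ k p) →+ ↥M' :=
    AddMonoidHom.mk' (fun x ↦ ⟨AddSubgroup.inclusion (integralHodgeClassesIn_le_integralForms Φ k p) x, hmemM' _ x.2⟩)
      fun x y ↦ Subtype.ext (map_add _ x y)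
  have hφ : Surjective φ := fun y ↦
    ⟨⟨((y : ↥M') : ↥(integralForms Φ k)), (mem_integralHodgeClassesIn_iff Φ).2 ⟨((y : ↥M') : ↥(integralForms Φ k)).2,
      (mem_typeSubmodule_iff_isOfTypeAt hpk).2 ((hM' _).1 y.2)⟩⟩, Subtype.ext (Subtype.ext rfl)⟩
  have hcomap : (S₀.comap M'.subtype).toAddSubgroup.comap φ =
      (S₀.comap (AddSubgroup.inclusion (integralHodgeClassesIn_le_integralForms Φ k p)).toIntLinearMap).toAddSubgroup :=
    AddSubgroup.ext fun _ ↦ Iff.rfl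
  rw [← hcomap, AddSubgroup.index_comap_of_surjective _ hφ]

omit [DecidableEq ι] in
/-- **The index recursion in the `Hdg(X, ℤ)`-currency of g47-#4, and `0 < J_{p+1}` WITHOUT bilinear forms**:
`[Hdgᵖ⁺¹(X, ℤ) : ⊕_s N'_s] = J_{p+1} · [Hdgᵖ(X, ℤ) : ⊕_s N_s]` with the indices of the pull-backs along `Hdg(X, ℤ) ↪ H(X, ℤ)` (§4's bridge, twice), and since
the left side is positive (g47-#4's `index_comap_iSup_lefschetzPieces_pos`: full rank), the one-step index `J_{p+1} = [Hdgᵖ⁺¹(X, ℤ) : θ ∧ Hdgᵖ(X, ℤ) ⊕ P]`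
is positive too (g47-#1 obtained `0 < J` through the Lefschetz similarity and `disc ≠ 0`).
[cite: Lange2023AbelianVarietiesComplex, §5.4.1 Thm. 5.4.2 and (5.22)–(5.23) (PDF p. 275); §7.3.2 (3)] [cite: Huybrechts2016K3, Ch. 14 §0.1, §0.2] -/
theorem IsPolarizationType.index_comap_inclusion_iSup_lefschetzPieces_succ_eq_mul (hd : IsPolarizationType Φ η d) (hη : IsRiemannForm Φ η)
    (hp : 2 * p + 2 ≤ j + 2) {M : Submodule ℤ ↥(integralForms Φ (2 * p + 2))}
    (hM : ∀ x : ↥(integralForms Φ (2 * p + 2)), x ∈ M ↔ IsOfTypeAt (p + 1) (p + 1) (x : E [⋀^Fin (2 * p + 2)]→L[ℝ] ℂ))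
    {M' : Submodule ℤ ↥(integralForms Φ (2 * p))}
    (hM' : ∀ x : ↥(integralForms Φ (2 * p)), x ∈ M' ↔ IsOfTypeAt p p (x : E [⋀^Fin (2 * p)]→L[ℝ] ℂ)) (T : ↥M' →ₗ[ℤ] ↥M)
    (hT : ∀ x : ↥M', (((T x : ↥M) : ↥(integralForms Φ (2 * p + 2))) : E [⋀^Fin (2 * p + 2)]→L[ℝ] ℂ) =
      (((x : ↥M') : ↥(integralForms Φ (2 * p))) : E [⋀^Fin (2 * p)]→L[ℝ] ℂ).wedge (ofRealForm η : E [⋀^Fin 2]→L[ℝ] ℂ))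
    {L₂ : Submodule ℤ ↥M} (hmemL₂ : ∀ u : ↥M, u ∈ L₂ ↔ ∃ w : ↥M', T w = u) {P : Submodule ℤ ↥M}
    (hP : ∀ z : ↥M, z ∈ P ↔ (((z : ↥M) : ↥(integralForms Φ (2 * p + 2))) : E [⋀^Fin (2 * p + 2)]→L[ℝ] ℂ) ∈ primitiveForms η (2 * p + 2))
    (N : Fin (p + 1) → Submodule ℤ ↥(integralForms Φ (2 * p)))
    (hN : ∀ (s : Fin (p + 1)) (u : ↥(integralForms Φ (2 * p))), u ∈ N s ↔
      ∃ (m i : ℕ) (_ : i + i = m) (h : 2 * (s : ℕ) + m = 2 * p) (y : E [⋀^Fin m]→L[ℝ] ℂ),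
        y ∈ integralHodgeClassesIn Φ m i ∧ y ∈ primitiveForms η m ∧ (u : E [⋀^Fin (2 * p)]→L[ℝ] ℂ) = lefschetzPow η (s : ℕ) h y)
    (N' : Fin (p + 1 + 1) → Submodule ℤ ↥(integralForms Φ (2 * p + 2)))
    (hN' : ∀ (s : Fin (p + 1 + 1)) (u : ↥(integralForms Φ (2 * p + 2))), u ∈ N' s ↔
      ∃ (m i : ℕ) (_ : i + i = m) (h : 2 * (s : ℕ) + m = 2 * p + 2) (y : E [⋀^Fin m]→L[ℝ] ℂ),
        y ∈ integralHodgeClassesIn Φ m i ∧ y ∈ primitiveForms η m ∧ (u : E [⋀^Fin (2 * p + 2)]→L[ℝ] ℂ) = lefschetzPow η (s : ℕ) h y) :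
    ((⨆ s, N' s).comap (AddSubgroup.inclusion (integralHodgeClassesIn_le_integralForms Φ (2 * p + 2) (p + 1))).toIntLinearMap).toAddSubgroup.index =
      (L₂ ⊔ P).toAddSubgroup.index *
        ((⨆ s, N s).comap (AddSubgroup.inclusion (integralHodgeClassesIn_le_integralForms Φ (2 * p) p)).toIntLinearMap).toAddSubgroup.index ∧
    0 < (L₂ ⊔ P).toAddSubgroup.index := by
  have h := hd.index_comap_iSup_lefschetzPieces_succ_eq_mul hη hp hM hM' T hT hmemL₂ hP N hN N' hN'
  rw [index_comap_subtype_eq_index_comap_inclusion (by ring) hM', index_comap_subtype_eq_index_comap_inclusion (by ring) hM] at h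
  refine ⟨h, Nat.pos_of_ne_zero fun h0 ↦ ?_⟩
  have hpos := hd.index_comap_iSup_lefschetzPieces_pos hη (show p + 1 + (p + 1) = 2 * p + 2 by ring) hp N' hN'
  rw [h, h0, zero_mul] at hpos
  exact lt_irrefl 0 hpos

/-! ## §5 The base of the ladder: `I_0 = 1` -/

omit [DecidableEq ι] in
/-- **`I_0 = [Hdg⁰(X, ℤ) : N_0] = 1`**: in degree `0` every class is primitive (`θ^{∧(g+1)} = 0` in real dimension `2g`), so the unique Lefschetz piece
`N_0 = L⁰ Hdg⁰(X, ℤ)_prim` is all of `Hdg⁰(X, ℤ) = H⁰(X, ℤ) = ℤ`. [cite: Lange2023AbelianVarietiesComplex, §7.3.2 (3); §5.4.1 (5.22) (PDF p. 275)] [cite: VoisinHodgeI2002, §6.2.3 Rem. 6.27 (PDF p. 126)] -/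
theorem index_comap_iSup_lefschetzPieces_zero_eq_one (Φ : (ι → ℝ) ≃L[ℝ] E) (η : E [⋀^Fin 2]→L[ℝ] ℝ) {M₀ : Submodule ℤ ↥(integralForms Φ (2 * 0))}
    (hM₀ : ∀ x : ↥(integralForms Φ (2 * 0)), x ∈ M₀ ↔ IsOfTypeAt 0 0 (x : E [⋀^Fin (2 * 0)]→L[ℝ] ℂ))
    (N : Fin (0 + 1) → Submodule ℤ ↥(integralForms Φ (2 * 0)))
    (hN : ∀ (s : Fin (0 + 1)) (u : ↥(integralForms Φ (2 * 0))), u ∈ N s ↔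
      ∃ (m i : ℕ) (_ : i + i = m) (h : 2 * (s : ℕ) + m = 2 * 0) (y : E [⋀^Fin m]→L[ℝ] ℂ),
        y ∈ integralHodgeClassesIn Φ m i ∧ y ∈ primitiveForms η m ∧ (u : E [⋀^Fin (2 * 0)]→L[ℝ] ℂ) = lefschetzPow η (s : ℕ) h y) :
    ((⨆ s, N s).comap M₀.subtype).toAddSubgroup.index = 1 := by
  haveI : FiniteDimensional ℝ E := Module.Finite.equiv Φ.toLinearEquiv
  haveI : FiniteDimensional ℂ E := Module.Finite.of_restrictScalars_finite ℝ ℂ E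
  have hprim : ∀ c : E [⋀^Fin 0]→L[ℝ] ℂ, c ∈ primitiveForms η 0 := fun c ↦ by
    rw [mem_primitiveForms_iff, eq_zero_of_finrank_real_lt (wedgePow (ofRealForm η) (finrank ℂ E - 0 + 1))
      (by rw [finrank_real_of_complex]; omega), ContinuousAlternatingMap.zero_wedge]
  rw [AddSubgroup.index_eq_one, Submodule.toAddSubgroup_eq_top, eq_top_iff]
  intro x _
  have h00 : 2 * ((0 : Fin (0 + 1)) : ℕ) + 0 = 2 * 0 := rfl
  have hxH : ((x : ↥(integralForms Φ (2 * 0))) : E [⋀^Fin 0]→L[ℝ] ℂ) ∈ integralHodgeClassesIn Φ 0 0 :=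
    (mem_integralHodgeClassesIn_iff Φ).2 ⟨((x : ↥M₀) : ↥(integralForms Φ (2 * 0))).2,
      (mem_typeSubmodule_iff_isOfTypeAt (by ring)).2 ((hM₀ _).1 x.2)⟩
  refine Submodule.mem_iSup_of_mem (0 : Fin (0 + 1)) ((hN 0 _).2 ⟨0, 0, rfl, h00, _, hxH, hprim _, ?_⟩)
  rw [lefschetzPow_congr₈₆ η (show ((0 : Fin (0 + 1)) : ℕ) = 0 from rfl) h00 (by ring), lefschetzPow_zero_apply]
  rfl

/-! ## §6 The closed form `I_p = ∏_{q < p} J_{q+1}` along the whole ladder -/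

omit [DecidableEq ι] in
/-- **THE INDEX OF THE INTEGRAL LEFSCHETZ DECOMPOSITION IN CLOSED FORM: `[Hdgᵖ(X, ℤ) : ⊕_s Lˢ Hdg^{p−s}(X, ℤ)_prim] = ∏_{q < p} [Hdg^{q+1}(X, ℤ) : θ ∧ Hdg^q(X, ℤ) ⊕ Hdg^{q+1}(X, ℤ)_prim]`**
(`2p ≤ g`), for a LADDER of data indexed by the codimension `q`: the Hodge lattices `M_q = Hdg^q(X, ℤ) ⊆ H^{2q}(X, ℤ)` (cut out by type), the
Lefschetz maps `T_q : M_q → M_{q+1}`, `x ↦ x ∧ θ`, their images `L₂,q = T_q(M_q)`, the primitive sublattices `P_q ⊆ M_{q+1}`, and the families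
`N_q` of Lefschetz pieces in degree `2q` — §5's `I_0 = 1` and §3's recursion `I_{q+1} = J_{q+1} · I_q`, iterated.
[cite: Lange2023AbelianVarietiesComplex, §5.4.1 Thm. 5.4.2 and (5.22)–(5.23) (PDF p. 275); §7.3.2 (3)] [cite: Huybrechts2016K3, Ch. 14 §0.1, §0.2] [cite: Kitaoka1993, Ch. 5 §5.3 Prop. 5.3.3 (proof)] -/
theorem IsPolarizationType.index_comap_iSup_lefschetzPieces_eq_prod (hd : IsPolarizationType Φ η d) (hη : IsRiemannForm Φ η) (hp : 2 * p ≤ j + 2)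
    (M : (q : ℕ) → Submodule ℤ ↥(integralForms Φ (2 * q)))
    (hM : ∀ (q : ℕ) (x : ↥(integralForms Φ (2 * q))), x ∈ M q ↔ IsOfTypeAt q q (x : E [⋀^Fin (2 * q)]→L[ℝ] ℂ))
    (T : (q : ℕ) → ↥(M q) →ₗ[ℤ] ↥(M (q + 1)))
    (hT : ∀ (q : ℕ) (x : ↥(M q)), (((T q x : ↥(M (q + 1))) : ↥(integralForms Φ (2 * (q + 1)))) : E [⋀^Fin (2 * q + 2)]→L[ℝ] ℂ) =
      (((x : ↥(M q)) : ↥(integralForms Φ (2 * q))) : E [⋀^Fin (2 * q)]→L[ℝ] ℂ).wedge (ofRealForm η : E [⋀^Fin 2]→L[ℝ] ℂ))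
    (L₂ : (q : ℕ) → Submodule ℤ ↥(M (q + 1))) (hmemL₂ : ∀ (q : ℕ) (u : ↥(M (q + 1))), u ∈ L₂ q ↔ ∃ w : ↥(M q), T q w = u)
    (P : (q : ℕ) → Submodule ℤ ↥(M (q + 1)))
    (hP : ∀ (q : ℕ) (z : ↥(M (q + 1))), z ∈ P q ↔
      (((z : ↥(M (q + 1))) : ↥(integralForms Φ (2 * (q + 1)))) : E [⋀^Fin (2 * q + 2)]→L[ℝ] ℂ) ∈ primitiveForms η (2 * q + 2))
    (N : (q : ℕ) → Fin (q + 1) → Submodule ℤ ↥(integralForms Φ (2 * q)))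
    (hN : ∀ (q : ℕ) (s : Fin (q + 1)) (u : ↥(integralForms Φ (2 * q))), u ∈ N q s ↔
      ∃ (m i : ℕ) (_ : i + i = m) (h : 2 * (s : ℕ) + m = 2 * q) (y : E [⋀^Fin m]→L[ℝ] ℂ),
        y ∈ integralHodgeClassesIn Φ m i ∧ y ∈ primitiveForms η m ∧ (u : E [⋀^Fin (2 * q)]→L[ℝ] ℂ) = lefschetzPow η (s : ℕ) h y) :
    ((⨆ s, N p s).comap (M p).subtype).toAddSubgroup.index = ∏ q ∈ Finset.range p, (L₂ q ⊔ P q).toAddSubgroup.index := by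
  induction p with
  | zero =>
    rw [Finset.prod_range_zero]
    exact index_comap_iSup_lefschetzPieces_zero_eq_one Φ η (hM 0) (N 0) (hN 0)
  | succ q ih =>
    rw [Finset.prod_range_succ, ← ih (by omega)]
    exact (hd.index_comap_iSup_lefschetzPieces_succ_eq_mul hη (by omega) (hM (q + 1)) (hM q) (T q) (hT q) (hmemL₂ q) (hP q)
      (N q) (hN q) (N (q + 1)) (hN (q + 1))).trans (Nat.mul_comm _ _)

end Recursion

end Literature.Geometry.Kaehler.ComplexTorus

end
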